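import Literature.Analysis.FluidPDE.StretchedLayerNS
import HarnessLib

/-!
# Tools for the stub `stub_braidExit` (line `braid-closed-large-circulation-gluing`, crux
# stmt-AnomalousDissipation-3009), part B: angular corrector, outer-domain lemmas, and the missing saddle layer

Notation as in part A (`…StubBraidExitTools`): `a = 2πx/L`, `b = 2πy/L`, `D = cosh b − cos a`,
`E = cosh b + cos a`, drift `U₀ = (sinh b/(2D), −sin a/(2D) − y)`, `𝒜 = νΔ + U₀·∇`, `k = π/(2L)`.
This file is independent of part A (statements are written with `cosh b ∓ cos a` literally).

## Contents (namespace `…MarginalStabilityChainStretchedVortexRows.BraidExit`)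

* Far-field numerics: `sq_div_le_mul_sinh_div : t²/(2+|t|) ≤ t sinh t/(cosh t + 1)` (from
  `1 + t ≤ eᵗ`) and `one_le_mul_sinh_div`: the compression factor `b sinh b/(cosh b + 1) ≥ 1` for
  `|y| ≥ L/2` — with part A's `rowOperator_radialLayer_le`, `𝒜 G(log D) ≤ −G'(log D)` there.
* The harmonic angular corrector `rowS = sin a sinh b` (`= (2π/L)² x y + …` at a core, the planner's
  rotating `m = 2` corrector in closed form): `dX_/dY_/dXX_/dYY_rowS`, `lap_rowS = 0`, the exact
  transport identity `rowOperator_rowS : 𝒜S = (π/L)(cos a sinh²b − sin²a cosh b)/D − b sin a cosh b`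
  and the algebra `cos a sinh²b − sin²a cosh b = E(cos a cosh b − 1) = −E·D + E(cosh b − 1)(1 + cos a)`
  (`cos_mul_sinh_sq_sub`, `rowE_mul_sub_one`): on the axis `𝒜S = −(π/L)(1 + cos a)`, near a core
  `𝒜((L/π)S) ≈ −2 cos 2θ`.
* The outer domain `Ω = {∀ n : ℤ, r² < (x − nL)² + y²}`: `isOpen_outer` (locally finitely many `n`),
  `closure_outer_subset` (`⊆ {∀ n, r² ≤ …}`), and `cosh_sub_cos_ge_of_forall`: for `0 < r ≤ L/4`,
  `D ≥ 1 − cos(2πr/L) > 0` on the closed outer domain (the minimum over a core circle sits on the axis;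
  via `sq_div_two_le_cosh_sub_one : t²/2 ≤ cosh t − 1` and `cos_add_sq_mono : cos t + t²/2 ↑`).

## The intended assembly and what is missing (worker's analysis for the lead — NOT a cited fact)

GLOBAL LYAPUNOV LAYER (on paper, from the exact identities of parts A/B). For `Ψ = G(log D) + κ(L/π)S`,
`U₀·∇Ψ = −G'(log D)·b sinh b/D − κE + κE(cosh b − 1)(1 + cos a)/D − κ(L/π) b sin a cosh b`; with
`cosh b − 1 ≤ b sinh b/2`, `E ≤ cosh 1 + 1` (`|b| ≤ 1`), `L ≤ 1`, `|b sin a|·0.49 ≤ (b² + sin²a)/4 ≤ …`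
one gets, for `G' ≥ 5.1κ` on the cells, `U₀·∇Ψ ≤ −(G'/2) b sinh b/D − (κ/2)[(cosh b − 1) + (1 + cos a)]`,
`≤ 0` with equality exactly at the saddles `((n+½)L, 0)`; `ΔG(log D) ≤ 0` for concave `G`, `ΔS = 0`.
So `Ψ` (with `G(s) = AΛ log(1 + (s − s₀)/Λ)`, `Λ = 1 + log(L²/ν)`, `s₀ = log(1 − cos(2πr/L))`, `S` cut
off in `1 ≤ |b| ≤ 2`) is periodic, smooth off the lattice, `0 ≤ Ψ ≤ C Λ (1 + log(1 + |y|/L))` on the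
closed outer domain, and `𝒜(MΨ) ≤ −1` OUTSIDE any fixed (scaled) neighbourhood of the saddles, for an
absolute `M`: far field, cells and cores need no further input (the fast rotation at the cores is never
averaged: `log D` is invariant under the row flow and `S` is the exact corrector).

SADDLE LAYER — THE BLOCKER. At a saddle the drift vanishes (linearisation `[[0, k], [k, −1]]`, rates
`σᵤ = (√(1 + 4k²) − 1)/2 ≥ 1.15`, `σₛ = −σᵤ − 1`), so `νΔφ ≤ −1` there and the exit time carries a
ridge of height `≍ σᵤ⁻¹ log(1/δ)`, `δ² ≍ ν(2π/L)²/σᵤ`, across the stable manifold `Wˢ`. On paper: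
(i) GIVEN a `C²` function `ξ` on the saddle disc with `{ξ = 0} = Wˢ_loc` invariant, i.e.
`U₀·∇ξ = m ξ`, `m ≥ σᵤ/2`, the ridge `R = (A/σᵤ) log((ξ² + ρ₀²)/(ξ² + δ²))` has `𝒜R ≤ −A/4` on the disc
(one-dimensional computation `ε'F″ + μξF′ ≤ −μ/4` for `F = −log(ξ² + δ²)`, `δ² = 4 max ε'/min μ`);
(ii) for ANY approximate coordinate whose zero set misses `Wˢ` by `η` (linear eigen-coordinate:
`η ≍ ρ³`; a jet of order `m`: `η ≍ ρ^{m+1}`; the exact conformal straightening of the ROW saddle,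
`ζ = √(−2 log cos(π(z − L/2)/L))`, in which `ẇ = ik tan w̄ − i Im w`: still `η ≍ ρ³/k` from the
strain), `𝒜R` acquires `+(A/σᵤ)|F′|·|U₀·∇ξ| ≍ A k η/δ → +∞` as `ν → 0` at `|ξ| ≍ δ` — no `ν`-uniform
inequality on any fixed neighbourhood, and no third function helps there (`U₀·∇Ψ = O(ρ²)`);
(iii) any supersolution dominates `E[τ]` (maximum principle), which keeps the ridge along the GLOBAL
stable manifold (upstream to `|y| → ∞`); cutting the ridge off at flow-distance `O(1)` upstream costs
`R·U₀·∇χ ≍ σᵤ⁻¹ log(1/ν)·k > 0`, not absorbable with `M` independent of `ν`; the ridge may only fade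
where its width has grown to `O(1)`, i.e. after flow-time `≍ log(1/ν)` upstream.
MISSING PIECE (no tree declaration; private conjecture `BraidExitSaddleLayer`, informal): for every
`L ∈ (0, 1]`, the stable manifolds of the saddles `((n+½)L, 0)` of `U₀` are `C²` curves admitting a
tubular `C²` coordinate `ξ` with `U₀·∇ξ = mξ`, `m > 0` near the saddle and `m ≥ 0`-controlled upstream,
tracked backward for flow-time `≍ log(L²/ν)`, with `L`-uniform bounds on `∇ξ, ∇²ξ, m` in the scaled
variables — a quantitative Hadamard–Perron / Briot–Bouquet statement for this explicit analytic family
(Mathlib has no stable-manifold theorem). With it, `φ = MΨ + Σ_saddles R` closes `stub_braidExit`; the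
statement itself is consistent (it is the expected-exit-time bound, `𝒜E[τ] = −1`, checked regime by
regime: far field `log(|y|/L)`, cells `O(1)` since `d(log D)/dt = −b sinh b/D`, cores `2 log(L/4r)`,
saddle passages `σᵤ⁻¹ log(1/δ) ≲ L log(L/ν) ≲ Λ`, uniformly in `L ≤ 1`). -/

-- `Summit.<Summit>.<Problem>` is the mandated summit-side namespace (CONVENTIONS §2): duplicate deliberate.
set_option linter.dupNamespace false

noncomputable section

open scoped Topology
open Filter Set

namespace Summit.AnomalousDissipation.AnomalousDissipation.Theorems.MarginalStabilityChainStretchedVortexRows.BraidExit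

open Literature.Analysis.FluidPDE Literature.Analysis.FluidPDE.StretchedLayer

variable {L : ℝ}

/-! ### Far-field numerics -/

/-- The elementary far-field bound `t²/(2 + |t|) ≤ t sinh t/(cosh t + 1)` (`= t tanh(t/2)`), from
`1 + t ≤ eᵗ`. [folklore] -/
theorem sq_div_le_mul_sinh_div (t : ℝ) :
    t ^ 2 / (2 + |t|) ≤ t * Real.sinh t / (Real.cosh t + 1) := by
  -- reduce to `t ≥ 0` by evenness
  suffices key : ∀ u : ℝ, 0 ≤ u → u ^ 2 / (2 + u) ≤ u * Real.sinh u / (Real.cosh u + 1) by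
    rcases le_total 0 t with ht | ht
    · simpa [abs_of_nonneg ht] using key t ht
    · have h := key (-t) (neg_nonneg.2 ht)
      rw [Real.sinh_neg, Real.cosh_neg, abs_of_nonpos ht] at *
      simpa using h
  intro u hu
  have hp : u + 1 ≤ Real.exp u := Real.add_one_le_exp u
  have hq : 0 < Real.exp (-u) := Real.exp_pos _
  have hpq : Real.exp u * Real.exp (-u) = 1 := by rw [← Real.exp_add]; simp
  have hcosh : 0 < Real.cosh u + 1 := by have := Real.one_le_cosh u; linarith
  rw [div_le_div_iff₀ (by positivity) hcosh, Real.sinh_eq, Real.cosh_eq]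
  nlinarith [mul_nonneg hu (sub_nonneg.2 hp), mul_nonneg (mul_nonneg hu hq.le) (sub_nonneg.2 hp),
    mul_nonneg hu hu]

/-- In the far field `|y| ≥ L/2` the compression factor `b sinh b/(cosh b + 1)` (`b = 2πy/L`) is at
least `π²/(2 + π) > 1`. [folklore] -/
theorem one_le_mul_sinh_div (hL : 0 < L) {y : ℝ} (hy : L / 2 ≤ |y|) :
    1 ≤ 2 * Real.pi * y / L * Real.sinh (2 * Real.pi * y / L) / (Real.cosh (2 * Real.pi * y / L) + 1) := by
  have h := sq_div_le_mul_sinh_div (2 * Real.pi * y / L)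
  have hb : Real.pi ≤ |2 * Real.pi * y / L| := by
    rw [abs_div, abs_mul, abs_of_pos hL, abs_of_pos (by positivity : (0:ℝ) < 2 * Real.pi),
      le_div_iff₀ hL]
    nlinarith [Real.pi_pos]
  have hπ : (3 : ℝ) ≤ Real.pi := by linarith [Real.pi_gt_three]
  have h1 : (1 : ℝ) ≤ (2 * Real.pi * y / L) ^ 2 / (2 + |2 * Real.pi * y / L|) := by
    rw [le_div_iff₀ (by positivity), ← sq_abs]
    nlinarith
  exact h1.trans h

/-! ### The harmonic angular corrector `S = sin a · sinh b` -/

/-- The angular (m = 2 near the cores) corrector `S(x,y) = sin(2πx/L) sinh(2πy/L) = −Im cos(2πz/L)`,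
harmonic; near a core `S ≈ (2π/L)² x y`, on the axis `U₀·∇S = −(π/L)(1 + cos a)`. [folklore] -/
def rowS (L x y : ℝ) : ℝ := Real.sin (2 * Real.pi * x / L) * Real.sinh (2 * Real.pi * y / L)

/-- `d/ds (2πs/L) = 2π/L`. [folklore] -/
theorem hasDerivAt_lin (L x : ℝ) : HasDerivAt (fun s : ℝ => 2 * Real.pi * s / L) (2 * Real.pi / L) x := by
  simpa using ((hasDerivAt_id x).const_mul (2 * Real.pi)).div_const L

/-- `∂ₓ S`. [folklore] -/
theorem hasDerivAt_rowS_fst (L x y : ℝ) :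
    HasDerivAt (fun s => rowS L s y)
      (2 * Real.pi / L * Real.cos (2 * Real.pi * x / L) * Real.sinh (2 * Real.pi * y / L)) x := by
  unfold rowS
  have h := ((hasDerivAt_lin L x).sin).mul_const (Real.sinh (2 * Real.pi * y / L))
  exact h.congr_deriv (by ring)

/-- `∂_y S`. [folklore] -/
theorem hasDerivAt_rowS_snd (L x y : ℝ) :
    HasDerivAt (fun s => rowS L x s)
      (2 * Real.pi / L * Real.sin (2 * Real.pi * x / L) * Real.cosh (2 * Real.pi * y / L)) y := by
  unfold rowS
  have h := ((hasDerivAt_lin L y).sinh).const_mul (Real.sin (2 * Real.pi * x / L))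
  exact h.congr_deriv (by ring)

/-- `∂ₓ S = (2π/L) cos a sinh b`. [folklore] -/
theorem dX_rowS (L : ℝ) : dX (rowS L) = fun x y =>
    2 * Real.pi / L * Real.cos (2 * Real.pi * x / L) * Real.sinh (2 * Real.pi * y / L) := by
  funext x y; exact (hasDerivAt_rowS_fst L x y).deriv

/-- `∂_y S = (2π/L) sin a cosh b`. [folklore] -/
theorem dY_rowS (L : ℝ) : dY (rowS L) = fun x y =>
    2 * Real.pi / L * Real.sin (2 * Real.pi * x / L) * Real.cosh (2 * Real.pi * y / L) := by
  funext x y; exact (hasDerivAt_rowS_snd L x y).deriv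

/-- `∂ₓ∂ₓ S = −(2π/L)² S`. [folklore] -/
theorem dXX_rowS (L x y : ℝ) : dX (dX (rowS L)) x y =
    -((2 * Real.pi / L) ^ 2 * Real.sin (2 * Real.pi * x / L) * Real.sinh (2 * Real.pi * y / L)) := by
  rw [dX_rowS]
  show deriv (fun s => 2 * Real.pi / L * Real.cos (2 * Real.pi * s / L) *
    Real.sinh (2 * Real.pi * y / L)) x = _
  have h := (((hasDerivAt_lin L x).cos).const_mul (2 * Real.pi / L)).mul_const
    (Real.sinh (2 * Real.pi * y / L))
  rw [h.deriv]; ring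

/-- `∂_y∂_y S = (2π/L)² S`. [folklore] -/
theorem dYY_rowS (L x y : ℝ) : dY (dY (rowS L)) x y =
    (2 * Real.pi / L) ^ 2 * Real.sin (2 * Real.pi * x / L) * Real.sinh (2 * Real.pi * y / L) := by
  rw [dY_rowS]
  show deriv (fun s => 2 * Real.pi / L * Real.sin (2 * Real.pi * x / L) *
    Real.cosh (2 * Real.pi * s / L)) y = _
  have h := ((hasDerivAt_lin L y).cosh).const_mul (2 * Real.pi / L * Real.sin (2 * Real.pi * x / L))
  rw [h.deriv]; ring

/-- `S` is harmonic: `ΔS = 0`. [folklore] -/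
theorem lap_rowS (L x y : ℝ) : lap (rowS L) x y = 0 := by
  rw [lap_apply, dXX_rowS, dYY_rowS]; ring

/-- The trigonometric identity behind the transport of `S`:
`cos a sinh² b − sin² a cosh b = E (cos a cosh b − 1)`. [folklore] -/
theorem cos_mul_sinh_sq_sub (L x y : ℝ) :
    Real.cos (2 * Real.pi * x / L) * Real.sinh (2 * Real.pi * y / L) ^ 2 -
        Real.sin (2 * Real.pi * x / L) ^ 2 * Real.cosh (2 * Real.pi * y / L) =
      (Real.cosh (2 * Real.pi * y / L) + Real.cos (2 * Real.pi * x / L)) *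
        (Real.cos (2 * Real.pi * x / L) * Real.cosh (2 * Real.pi * y / L) - 1) := by
  have h1 := Real.sin_sq_add_cos_sq (2 * Real.pi * x / L)
  have h2 := Real.cosh_sq_sub_sinh_sq (2 * Real.pi * y / L)
  linear_combination (-Real.cos (2 * Real.pi * x / L)) * h2 - Real.cosh (2 * Real.pi * y / L) * h1

/-- … and `E (cos a cosh b − 1) = −E·D + E (cosh b − 1)(1 + cos a)`: the transport of `(L/π)S` is `−E`
plus `E(cosh b − 1)(1 + cos a)/D ≥ 0`, which vanishes on the axis and is `≈ 4 sin²θ` near a core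
(there `E ≈ 2`, so the total is `≈ −2 cos 2θ`, the `m = 2` corrector), minus `(L/π) b sin a cosh b`.
[folklore] -/
theorem rowE_mul_sub_one (L x y : ℝ) :
    (Real.cosh (2 * Real.pi * y / L) + Real.cos (2 * Real.pi * x / L)) *
        (Real.cos (2 * Real.pi * x / L) * Real.cosh (2 * Real.pi * y / L) - 1) =
      -((Real.cosh (2 * Real.pi * y / L) + Real.cos (2 * Real.pi * x / L)) *
          (Real.cosh (2 * Real.pi * y / L) - Real.cos (2 * Real.pi * x / L))) +
        (Real.cosh (2 * Real.pi * y / L) + Real.cos (2 * Real.pi * x / L)) *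
          ((Real.cosh (2 * Real.pi * y / L) - 1) * (1 + Real.cos (2 * Real.pi * x / L))) := by
  ring

/-- **The passive row operator on the corrector** (exact identity, every point of the plane):
`ν ΔS + U₀·∇S = (π/L) (cos a sinh² b − sin² a cosh b)/D − (2πy/L) sin a cosh b`. [folklore] -/
theorem rowOperator_rowS (ν L x y : ℝ) :
    ν * lap (rowS L) x y +
        Real.sinh (2 * Real.pi * y / L) /
            (2 * (Real.cosh (2 * Real.pi * y / L) - Real.cos (2 * Real.pi * x / L))) *
          dX (rowS L) x y +
        (-(Real.sin (2 * Real.pi * x / L) /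
            (2 * (Real.cosh (2 * Real.pi * y / L) - Real.cos (2 * Real.pi * x / L)))) - y) *
          dY (rowS L) x y =
      Real.pi / L *
          (Real.cos (2 * Real.pi * x / L) * Real.sinh (2 * Real.pi * y / L) ^ 2 -
            Real.sin (2 * Real.pi * x / L) ^ 2 * Real.cosh (2 * Real.pi * y / L)) /
          (Real.cosh (2 * Real.pi * y / L) - Real.cos (2 * Real.pi * x / L)) -
        2 * Real.pi * y / L * Real.sin (2 * Real.pi * x / L) * Real.cosh (2 * Real.pi * y / L) := by
  rw [lap_rowS, dX_rowS, dY_rowS]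
  simp only [div_eq_mul_inv, mul_inv]
  ring

/-! ### The outer domain: openness, closure, and `D` on it -/

/-- The outer domain `Ω = {∀ n, r² < (x − nL)² + y²}` (plane minus the closed core discs about
`Lℤ × {0}`) is open for `L > 0`: near a point only finitely many `n` matter. [folklore] -/
theorem isOpen_outer (hL : 0 < L) (r : ℝ) :
    IsOpen {q : ℝ × ℝ | ∀ n : ℤ, r ^ 2 < (q.1 - n * L) ^ 2 + q.2 ^ 2} := by
  rw [isOpen_iff_mem_nhds]
  intro q hq
  set I : Set ℤ := {n : ℤ | |q.1 - n * L| ≤ |r| + 1} with hI_def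
  have hI : I.Finite := by
    refine (Set.finite_Icc ⌈(q.1 - (|r| + 1)) / L⌉ ⌊(q.1 + (|r| + 1)) / L⌋).subset ?_
    intro n hn
    have hn' : |q.1 - n * L| ≤ |r| + 1 := hn
    rw [abs_le] at hn'
    refine ⟨Int.ceil_le.2 ?_, Int.le_floor.2 ?_⟩
    · rw [div_le_iff₀ hL]; linarith
    · rw [le_div_iff₀ hL]; linarith
  have h1 : ∀ᶠ q' in 𝓝 q, ∀ n ∈ I, r ^ 2 < (q'.1 - n * L) ^ 2 + q'.2 ^ 2 := by
    refine hI.eventually_all.2 fun n _ => ?_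
    have ho : IsOpen {q' : ℝ × ℝ | r ^ 2 < (q'.1 - n * L) ^ 2 + q'.2 ^ 2} :=
      isOpen_lt continuous_const (by fun_prop)
    exact ho.mem_nhds (hq n)
  have h2 : ∀ᶠ q' in 𝓝 q, |q'.1 - q.1| < 1 := by
    have hc : ContinuousAt (fun q' : ℝ × ℝ => |q'.1 - q.1|) q :=
      (Continuous.continuousAt (by fun_prop))
    have : (fun q' : ℝ × ℝ => |q'.1 - q.1|) q < 1 := by simp
    exact hc.eventually (Iio_mem_nhds this)
  filter_upwards [h1, h2] with q' h1' h2' n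
  by_cases hn : n ∈ I
  · exact h1' n hn
  · have hn' : |r| + 1 < |q.1 - n * L| := lt_of_not_ge hn
    have h3 : |q.1 - n * L| - |q'.1 - n * L| ≤ |(q.1 - n * L) - (q'.1 - n * L)| :=
      abs_sub_abs_le_abs_sub _ _
    have h4 : |(q.1 - n * L) - (q'.1 - n * L)| < 1 := by
      rw [show (q.1 - n * L) - (q'.1 - n * L) = -(q'.1 - q.1) by ring, abs_neg]; exact h2'
    have h5 : |r| < |q'.1 - n * L| := by linarith
    calc r ^ 2 = |r| ^ 2 := (sq_abs r).symm
      _ < |q'.1 - n * L| ^ 2 := by gcongr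
      _ = (q'.1 - n * L) ^ 2 := sq_abs _
      _ ≤ (q'.1 - n * L) ^ 2 + q'.2 ^ 2 := by nlinarith

/-- The closure of the outer domain lies in `{∀ n, r² ≤ (x − nL)² + y²}` (plane minus the OPEN discs). [folklore] -/
theorem closure_outer_subset (L r : ℝ) :
    closure {q : ℝ × ℝ | ∀ n : ℤ, r ^ 2 < (q.1 - n * L) ^ 2 + q.2 ^ 2} ⊆
      {q : ℝ × ℝ | ∀ n : ℤ, r ^ 2 ≤ (q.1 - n * L) ^ 2 + q.2 ^ 2} := by
  refine closure_minimal (fun q hq n => (hq n).le) ?_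
  have : {q : ℝ × ℝ | ∀ n : ℤ, r ^ 2 ≤ (q.1 - n * L) ^ 2 + q.2 ^ 2} =
      ⋂ n : ℤ, {q : ℝ × ℝ | r ^ 2 ≤ (q.1 - n * L) ^ 2 + q.2 ^ 2} := by
    ext q; simp
  rw [this]
  exact isClosed_iInter fun n => isClosed_le continuous_const (by fun_prop)

/-- `t²/2 ≤ cosh t − 1`. [folklore] -/
theorem sq_div_two_le_cosh_sub_one (t : ℝ) : t ^ 2 / 2 ≤ Real.cosh t - 1 := by
  have h1 : Real.cosh t = 2 * Real.sinh (t / 2) ^ 2 + 1 := by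
    have := Real.cosh_two_mul (t / 2)
    rw [show 2 * (t / 2) = t by ring] at this
    nlinarith [Real.cosh_sq (t / 2)]
  have h2 : (t / 2) ^ 2 ≤ Real.sinh (t / 2) ^ 2 := by
    rw [← sq_abs (t / 2), ← sq_abs (Real.sinh (t / 2)), Real.abs_sinh]
    have h := Real.self_le_sinh_iff.2 (abs_nonneg (t / 2))
    exact pow_le_pow_left₀ (abs_nonneg _) h 2
  nlinarith

/-- `t ↦ cos t + t²/2` is monotone on `[0, ∞)` (`(cos t + t²/2)' = t − sin t ≥ 0`). [folklore] -/
theorem cos_add_sq_mono {u v : ℝ} (hu : 0 ≤ u) (huv : u ≤ v) :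
    Real.cos u + u ^ 2 / 2 ≤ Real.cos v + v ^ 2 / 2 := by
  have hmono : MonotoneOn (fun t : ℝ => Real.cos t + t ^ 2 / 2) (Ici 0) := by
    refine monotoneOn_of_deriv_nonneg (convex_Ici 0) (by fun_prop) (by fun_prop) fun t ht => ?_
    rw [interior_Ici] at ht
    have hd : HasDerivAt (fun t : ℝ => Real.cos t + t ^ 2 / 2) (-Real.sin t + t) t := by
      have := (Real.hasDerivAt_cos t).add ((hasDerivAt_pow 2 t).div_const 2)
      exact this.congr_deriv (by ring)
    rw [hd.deriv]
    linarith [Real.sin_le (le_of_lt ht)]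
  exact hmono hu (hu.trans huv) huv

/-- **`D` on the closed outer domain**: if `0 < r ≤ L/4` and `(x, y)` is outside all the open core
discs, then `D(x,y) ≥ 1 − cos(2πr/L) > 0` — the minimum of `D` over a core circle is attained on the
axis. Hence `log D ≥ log(1 − cos(2πr/L)) ≥ log(r²/L²) + const` on `closure Ω`. [folklore] -/
theorem cosh_sub_cos_ge_of_forall (hL : 0 < L) {r : ℝ} (hr : 0 < r) (hrL : r ≤ L / 4) {x y : ℝ}
    (h : ∀ n : ℤ, r ^ 2 ≤ (x - n * L) ^ 2 + y ^ 2) :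
    1 - Real.cos (2 * Real.pi * r / L) ≤
      Real.cosh (2 * Real.pi * y / L) - Real.cos (2 * Real.pi * x / L) := by
  -- reduce `x` to the fundamental cell
  set n₀ : ℤ := round (x / L) with hn₀
  set d : ℝ := x - n₀ * L with hd
  have hdle : |d| ≤ L / 2 := by
    have h1 := abs_sub_round (x / L)
    have : d = L * (x / L - round (x / L)) := by rw [hd, hn₀]; field_simp
    rw [this, abs_mul, abs_of_pos hL]
    nlinarith
  have hcos : Real.cos (2 * Real.pi * x / L) = Real.cos (2 * Real.pi * d / L) := by
    have : 2 * Real.pi * x / L = 2 * Real.pi * d / L + n₀ * (2 * Real.pi) := by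
      rw [hd]; field_simp; ring
    rw [this, Real.cos_add_int_mul_two_pi]
  set ρ : ℝ := 2 * Real.pi * r / L with hρ
  have hρ0 : 0 ≤ ρ := by positivity
  have hρπ : ρ ≤ Real.pi / 2 := by
    rw [hρ, div_le_iff₀ hL]; nlinarith [Real.pi_pos]
  have hcosρ : 1 - Real.cos ρ ≤ ρ ^ 2 / 2 := by linarith [Real.one_sub_sq_div_two_le_cos (x := ρ)]
  set b : ℝ := 2 * Real.pi * y / L with hb
  have hcoshb : b ^ 2 / 2 ≤ Real.cosh b - 1 := sq_div_two_le_cosh_sub_one b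
  rw [hcos]
  rcases le_or_gt r |y| with hy | hy
  · -- far from the axis: `cosh b − 1` suffices
    have hy2 : r ^ 2 ≤ y ^ 2 := by rw [← sq_abs y]; exact pow_le_pow_left₀ hr.le hy 2
    have hb2 : ρ ^ 2 ≤ b ^ 2 := by
      rw [hρ, hb, div_pow, div_pow]
      apply div_le_div_of_nonneg_right _ (by positivity)
      have := mul_le_mul_of_nonneg_left hy2 (by positivity : (0:ℝ) ≤ (2 * Real.pi) ^ 2)
      calc (2 * Real.pi * r) ^ 2 = (2 * Real.pi) ^ 2 * r ^ 2 := by ring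
        _ ≤ (2 * Real.pi) ^ 2 * y ^ 2 := this
        _ = (2 * Real.pi * y) ^ 2 := by ring
    have hc1 := Real.cos_le_one (2 * Real.pi * d / L)
    nlinarith
  · -- near the axis: compare with the circle point on the axis side
    have hn := h n₀
    rw [← hd] at hn
    set u : ℝ := 2 * Real.pi * Real.sqrt (r ^ 2 - y ^ 2) / L with hu
    have hry : 0 ≤ r ^ 2 - y ^ 2 := by nlinarith [abs_nonneg y, sq_abs y]
    have hu0 : 0 ≤ u := by positivity
    have huρ : u ≤ ρ := by
      rw [hu, hρ]; gcongr
      rw [Real.sqrt_le_left hr.le]; nlinarith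
    have hud : u ≤ |2 * Real.pi * d / L| := by
      rw [abs_div, abs_mul, abs_of_pos hL, abs_of_pos (by positivity : (0:ℝ) < 2 * Real.pi), hu]
      gcongr
      rw [← Real.sqrt_sq_eq_abs]
      exact Real.sqrt_le_sqrt (by nlinarith)
    have hdπ : |2 * Real.pi * d / L| ≤ Real.pi := by
      rw [abs_div, abs_mul, abs_of_pos hL, abs_of_pos (by positivity : (0:ℝ) < 2 * Real.pi),
        div_le_iff₀ hL]
      nlinarith [Real.pi_pos]
    have hcosd : Real.cos (2 * Real.pi * d / L) ≤ Real.cos u := by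
      rw [← Real.cos_abs (2 * Real.pi * d / L)]
      exact Real.cos_le_cos_of_nonneg_of_le_pi hu0 hdπ hud
    have hmono := cos_add_sq_mono hu0 huρ
    have hbu : b ^ 2 + u ^ 2 = ρ ^ 2 := by
      rw [hb, hu, hρ, div_pow, div_pow, div_pow, mul_pow, mul_pow, mul_pow,
        Real.sq_sqrt hry]
      ring
    nlinarith

/-- **Registered sub-goal `stub_braidExit_outerDomain`** (def-free packaging of `isOpen_outer`,
`closure_outer_subset`, `cosh_sub_cos_ge_of_forall`): for `0 < r ≤ L/4` the outer domain of
`stub_braidExit` is open and `D = cosh b − cos a ≥ 1 − cos(2πr/L) (> 0)` on its closure — the regularity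
domain and the positivity floor of `log D` used by the radial layer. [folklore] -/
theorem stub_braidExit_outerDomain : ∀ (L r : ℝ), 0 < L → 0 < r → r ≤ L / 4 → IsOpen {q : ℝ × ℝ | ∀ n : ℤ, r ^ 2 < (q.1 - n * L) ^ 2 + q.2 ^ 2} ∧ ∀ q ∈ closure {q : ℝ × ℝ | ∀ n : ℤ, r ^ 2 < (q.1 - n * L) ^ 2 + q.2 ^ 2}, 1 - Real.cos (2 * Real.pi * r / L) ≤ Real.cosh (2 * Real.pi * q.2 / L) - Real.cos (2 * Real.pi * q.1 / L) := by
  intro L r hL hr hrL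
  exact ⟨isOpen_outer hL r, fun q hq => cosh_sub_cos_ge_of_forall hL hr hrL (closure_outer_subset L r hq)⟩

end Summit.AnomalousDissipation.AnomalousDissipation.Theorems.MarginalStabilityChainStretchedVortexRows.BraidExit

end
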